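import Literature.Probability.FitznerVanDerHofstad2017.PosExpr

/-!
# Literature.Probability.FitznerVanDerHofstad2017.PosExprEval — exact rational semantics of positive expressions

CITATION HEADER (PLACEMENT v2). Part of the certified REPRODUCTION of R. Fitzner, R. van der Hofstad, *Mean-field
behavior for nearest-neighbor percolation in d > 10*, EJP 22 (2017) no. 43 [FvdH17] (notebooks `Percolation.nb`,
`SRW.nb`, `General.nb`) and *Generalized approach to the non-backtracking lace expansion*, PTRF 169 (2017) 1041–1119
[NoBLE17]; build `lace`, seat lean1 (gen 7), GAPS G8 layer L1′ STEP 2 (kernel EVALUATION of the typed stage 1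
`Stage1Frame.Data.inp` / `Stage1Tails.inpFull` at certified rational tables).  ADDITIVE companion of `PosExpr.lean`
(nothing there is changed); no numeral of the notebooks, no verdict; nothing here is a cited fact.

What this module is.  `PosExpr.PX.eval` is the REAL semantics of the stage-1 syntax and is `noncomputable`.  To let
the kernel evaluate a typed cell at RATIONAL atom and table valuations (the certified, outward-rounded SRW tables of
the two engines are finite decimal = rational), this file gives the EXACT RATIONAL semantics `PX.evalQ` — the same
recursion over `ℚ`, written with the primitive recursor so that `decide +kernel` reduces it by `ι`-reduction (the
`brecOn` form of a pattern-matching definition is exponentially slow in the kernel: measured) — and the cast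
lemma `PX.eval_ratCast : eval (↑va) (↑vt) e = ↑(evalQ va vt e)`, so that an inequality between real cell values at
rational data is literally a decidable inequality between rationals.  It also records the TABLE-direction order facts
`PX.eval_mono_tab`, `PX.eval_mono_both`: a positive expression is order-preserving in the table valuation as well (atoms
fixed, everything `≥ 0`), which is what makes evaluation at UPPER enclosures of the SRW tables sound for the
upper-type cells.

MEASURED (scratch, not part of this file; farm `lean check`, d = 11, `Params := ⟨11, 12, 28⟩`, synthetic rational
atom/table valuations of realistic size): with this recursor form, `theorem _ : evalQ va vt (cell P) ≤ q := by
decide +kernel` elaborates for `Stage1Cells.B P 0 0`, `Xi1`, `Xi2` in 2.5 s wall for the whole file and for the five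
largest cells `Xi3`, `XiAbsD`, `XiIotaAbsDei`, `XiIotaAbsD0`, `C1BbarBC2 P 2 2` in 6 s wall, axioms `propext,
Classical.choice, Quot.sound` only (no `Lean.ofReduceBool`); the pattern-matching (`brecOn`) form of the same
definition needed 232 s for the single cell `openBubble P 1 0`.  The exact-inverse certificate goals of
`Stage1Tails.inpFull_dom_inpMaj` over a literal `Matrix (Fin 3) (Fin 3) ℚ` — `(1 - B * B) * S = 1` and
`∀ i j, 0 ≤ S i j` — are likewise closed by `decide +kernel` (< 2 s).  Hence the USE: state the rational data
`va, vt` as closed terms, prove `evalQ va vt (cell P) ≤ q` by `decide +kernel`, and transport to the real semantics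
with `eval_le_of_evalQ_le` (and to real UPPER tables with `eval_mono_tab`).

[folklore]
-/

namespace Literature.Probability.FitznerVanDerHofstad2017

namespace PX

variable {ι κ : Type}

/-- EXACT RATIONAL SEMANTICS of a positive expression under rational atom and table valuations: the recursion of
`PX.eval`, over `ℚ`.  Written with the primitive recursor `PX.rec` (not by structural pattern matching, whose
`brecOn` compilation the kernel reduces exponentially slowly), so that `decide +kernel` evaluates a stage-1 cell by
plain `ι`-reduction; `noncomputable` only because the code generator does not compile recursors — kernel reduction is
unaffected.  The constructor equations below hold by `rfl`. [folklore] -/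
noncomputable def evalQ (va : ι → ℚ) (vt : κ → ℚ) (e : PX ι κ) : ℚ :=
  @PX.rec ι κ (fun _ => ℚ) va vt (fun n => n) (fun _ _ ra rb => ra + rb) (fun _ _ ra rb => ra * rb)
    (fun _ n ra => ra / n) (fun _ _ ra rb => max ra rb) (fun _ _ ra rb => min ra rb) (fun _ n ra => ra ^ n)
    (fun _ n ra => 1 - (1 - ra) ^ (2 * n + 1)) (fun lo hi _ ih => ∑ j ∈ Finset.Icc lo hi, ih j) e

section Eqns

variable (va : ι → ℚ) (vt : κ → ℚ)

/-- `evalQ` on `atom`. [folklore] -/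
@[simp] theorem evalQ_atom (i : ι) : evalQ va vt (atom i) = va i := rfl
/-- `evalQ` on `tab`. [folklore] -/
@[simp] theorem evalQ_tab (k : κ) : evalQ va vt (tab k) = vt k := rfl
/-- `evalQ` on `num`. [folklore] -/
@[simp] theorem evalQ_num (n : ℕ) : evalQ va vt (num n) = n := rfl
/-- `evalQ` on `add`. [folklore] -/
@[simp] theorem evalQ_add' (a b : PX ι κ) : evalQ va vt (add a b) = evalQ va vt a + evalQ va vt b := rfl
/-- `evalQ` on `mul`. [folklore] -/
@[simp] theorem evalQ_mul' (a b : PX ι κ) : evalQ va vt (mul a b) = evalQ va vt a * evalQ va vt b := rfl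
/-- `evalQ` on `divN`. [folklore] -/
@[simp] theorem evalQ_divN (a : PX ι κ) (n : ℕ) : evalQ va vt (divN a n) = evalQ va vt a / n := rfl
/-- `evalQ` on `emax`. [folklore] -/
@[simp] theorem evalQ_emax (a b : PX ι κ) : evalQ va vt (emax a b) = max (evalQ va vt a) (evalQ va vt b) := rfl
/-- `evalQ` on `emin`. [folklore] -/
@[simp] theorem evalQ_emin (a b : PX ι κ) : evalQ va vt (emin a b) = min (evalQ va vt a) (evalQ va vt b) := rfl
/-- `evalQ` on `pow`. [folklore] -/
@[simp] theorem evalQ_pow' (a : PX ι κ) (n : ℕ) : evalQ va vt (pow a n) = evalQ va vt a ^ n := rfl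
/-- `evalQ` on `oddComp`. [folklore] -/
@[simp] theorem evalQ_oddComp (a : PX ι κ) (n : ℕ) :
    evalQ va vt (oddComp a n) = 1 - (1 - evalQ va vt a) ^ (2 * n + 1) := rfl
/-- `evalQ` on `sumR`. [folklore] -/
@[simp] theorem evalQ_sumR (lo hi : ℕ) (f : ℕ → PX ι κ) :
    evalQ va vt (sumR lo hi f) = ∑ j ∈ Finset.Icc lo hi, evalQ va vt (f j) := rfl
/-- `evalQ` on the notation `+`. [folklore] -/
@[simp] theorem evalQ_add (a b : PX ι κ) : evalQ va vt (a + b) = evalQ va vt a + evalQ va vt b := rfl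
/-- `evalQ` on the notation `*`. [folklore] -/
@[simp] theorem evalQ_mul (a b : PX ι κ) : evalQ va vt (a * b) = evalQ va vt a * evalQ va vt b := rfl
/-- `evalQ` on the notation `^`. [folklore] -/
@[simp] theorem evalQ_hpow (a : PX ι κ) (n : ℕ) : evalQ va vt (a ^ n) = evalQ va vt a ^ n := rfl
/-- `evalQ` on the notation `/`. [folklore] -/
@[simp] theorem evalQ_hdiv (a : PX ι κ) (n : ℕ) : evalQ va vt (a / n) = evalQ va vt a / n := rfl
/-- `evalQ` on the notation `/ₙ`. [folklore] -/
@[simp] theorem evalQ_divN' (a : PX ι κ) (n : ℕ) : evalQ va vt (a /ₙ n) = evalQ va vt a / n := rfl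
/-- `evalQ` on the notation `max`. [folklore] -/
@[simp] theorem evalQ_max (a b : PX ι κ) : evalQ va vt (max a b) = max (evalQ va vt a) (evalQ va vt b) := rfl
/-- `evalQ` on the notation `min`. [folklore] -/
@[simp] theorem evalQ_min (a b : PX ι κ) : evalQ va vt (min a b) = min (evalQ va vt a) (evalQ va vt b) := rfl
/-- `evalQ` on `C n`. [folklore] -/
@[simp] theorem evalQ_C (n : ℕ) : evalQ va vt (C n : PX ι κ) = n := rfl
/-- `evalQ` on numerals. [folklore] -/
@[simp] theorem evalQ_ofNat (n : ℕ) : evalQ va vt (OfNat.ofNat n : PX ι κ) = n := rfl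
/-- `evalQ` of a list sum. [folklore] -/
theorem evalQ_sumL {α : Type} (l : List α) (f : α → PX ι κ) :
    evalQ va vt (sumL l f) = (l.map fun a => evalQ va vt (f a)).sum := by
  induction l with
  | nil => rfl
  | cons a l ih =>
      simp only [sumL, List.foldr_cons, List.map_cons, List.sum_cons] at ih ⊢
      rw [evalQ_add', ih]

end Eqns

section Cast

variable (va : ι → ℚ) (vt : κ → ℚ)

/-- THE CAST LEMMA: the real value at the casts of rational valuations is the cast of the rational value. [folklore] -/
theorem eval_ratCast : ∀ e : PX ι κ,
    eval (fun i => (va i : ℝ)) (fun k => (vt k : ℝ)) e = ((evalQ va vt e : ℚ) : ℝ)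
  | atom i => rfl
  | tab k => rfl
  | num n => by simp [eval]
  | add a b => by rw [eval, evalQ_add', Rat.cast_add, eval_ratCast a, eval_ratCast b]
  | mul a b => by rw [eval, evalQ_mul', Rat.cast_mul, eval_ratCast a, eval_ratCast b]
  | divN a n => by rw [eval, evalQ_divN, Rat.cast_div, Rat.cast_natCast, eval_ratCast a]
  | emax a b => by rw [eval, evalQ_emax, Rat.cast_max, eval_ratCast a, eval_ratCast b]
  | emin a b => by rw [eval, evalQ_emin, Rat.cast_min, eval_ratCast a, eval_ratCast b]
  | pow a n => by rw [eval, evalQ_pow', Rat.cast_pow, eval_ratCast a]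
  | oddComp a n => by
      rw [eval, evalQ_oddComp, Rat.cast_sub, Rat.cast_one, Rat.cast_pow, Rat.cast_sub, Rat.cast_one, eval_ratCast a]
  | sumR lo hi f => by
      rw [eval, evalQ_sumR, Rat.cast_sum]
      exact Finset.sum_congr rfl fun j _ => eval_ratCast (f j)

/-- Real inequalities between cell values at rational data are rational inequalities (upper form). [folklore] -/
theorem eval_le_of_evalQ_le {e : PX ι κ} {q : ℚ} (h : evalQ va vt e ≤ q) :
    eval (fun i => (va i : ℝ)) (fun k => (vt k : ℝ)) e ≤ (q : ℝ) := by
  rw [eval_ratCast]; exact_mod_cast h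

/-- Real inequalities between cell values at rational data are rational inequalities (lower form). [folklore] -/
theorem le_eval_of_le_evalQ {e : PX ι κ} {q : ℚ} (h : q ≤ evalQ va vt e) :
    (q : ℝ) ≤ eval (fun i => (va i : ℝ)) (fun k => (vt k : ℝ)) e := by
  rw [eval_ratCast]; exact_mod_cast h

end Cast

section TabOrder

variable {va : ι → ℝ} {vt vt' : κ → ℝ}

/-- EVERY positive expression is ORDER-PRESERVING in the TABLE valuation too (atoms fixed): `vt ≤ vt'` pointwise,
atoms and tables `≥ 0` ⟹ `eval va vt ≤ eval va vt'`.  (Companion of `PX.eval_mono`, which varies the atoms; used to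
evaluate upper-type cells at UPPER enclosures of the SRW tables.) [folklore] -/
theorem eval_mono_tab (ha : ∀ i, 0 ≤ va i) (ht : ∀ k, 0 ≤ vt k) (hle : ∀ k, vt k ≤ vt' k) :
    ∀ e : PX ι κ, eval va vt e ≤ eval va vt' e
  | atom i => le_rfl
  | tab k => hle k
  | num n => le_rfl
  | add a b => add_le_add (eval_mono_tab ha ht hle a) (eval_mono_tab ha ht hle b)
  | mul a b => by
      have ht' : ∀ k, 0 ≤ vt' k := fun k => (ht k).trans (hle k)
      exact mul_le_mul (eval_mono_tab ha ht hle a) (eval_mono_tab ha ht hle b) (eval_nonneg ha ht b)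
        (eval_nonneg ha ht' a)
  | divN a n => div_le_div_of_nonneg_right (eval_mono_tab ha ht hle a) (Nat.cast_nonneg n)
  | emax a b => max_le_max (eval_mono_tab ha ht hle a) (eval_mono_tab ha ht hle b)
  | emin a b => min_le_min (eval_mono_tab ha ht hle a) (eval_mono_tab ha ht hle b)
  | pow a n => pow_le_pow_left₀ (eval_nonneg ha ht a) (eval_mono_tab ha ht hle a) n
  | oddComp a n => by
      have h := odd_pow_mono n (sub_le_sub_left (eval_mono_tab ha ht hle a) 1)
      show 1 - (1 - eval va vt a) ^ (2 * n + 1) ≤ 1 - (1 - eval va vt' a) ^ (2 * n + 1)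
      linarith
  | sumR lo hi f => Finset.sum_le_sum fun j _ => eval_mono_tab ha ht hle (f j)

/-- Joint form: order-preserving in atoms AND tables at once. [folklore] -/
theorem eval_mono_both {va' : ι → ℝ} (ha : ∀ i, 0 ≤ va i) (hale : ∀ i, va i ≤ va' i) (ht : ∀ k, 0 ≤ vt k)
    (hle : ∀ k, vt k ≤ vt' k) (e : PX ι κ) : eval va vt e ≤ eval va' vt' e :=
  (eval_mono ha hale ht e).trans (eval_mono_tab (fun i => (ha i).trans (hale i)) ht hle e)

end TabOrder

end PX

end Literature.Probability.FitznerVanDerHofstad2017
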